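import Literature.Probability.Percolation.KozmaNitzanPinning
import Literature.Probability.Percolation.KozmaNitzanHittable
import HarnessLib

/-!
# Kozma–Nitzan's Conjecture 1 transferred: finite vertex types, finitely supported weights, target sets, the lattice

Topic `Literature/Probability/Percolation`. Proofs-only companion of `KozmaNitzanPinning.lean` /
`KozmaNitzanHittable.lean` (G. Kozma, S. Nitzan, *A reduction of the `θ(p_c) = 0` problem to a conjectured
inequality*, arXiv:2401.12397). Those files transport Conjecture 3 (`KozmaNitzan2024_conjecture3.fintype`,
`.finSupp`, `.openConn_set`); this file transports CONJECTURE 1 in exactly the same way.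

Conjecture 1 (p. 3, verbatim): "Let `G` be a finite graph with arbitrary probabilities on its edges, let
`0, b ∈ G` be two vertices and let `A ⊂ G` be a set of vertices. Then
`P(0 ↔ b) ≥ P(0 ↔ A) min{P(a ↔ b) : a ∈ A}`." It is used here only as a HYPOTHESIS, typed min-free over
`Fin n` (every common lower bound `t` of the `P(a ↔ b)`, `a ∈ A`, satisfies `P(o ↔ A) · t ≤ P(o ↔ b)`),
which is the typing used by the crux chains of `PercolationContinuityZ3` (`NearOneGluing`, `BGNOffTheFloor`).
Nothing in this file asserts the conjecture (the authors "were not able to prove or disprove" it, p. 3).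

* `KozmaNitzan.Conj1.fintype` — Conjecture 1 over every finite vertex type (relabelling along `Fintype.equivFin`);
* `KozmaNitzan.Conj1.finSupp` — for finitely supported weights on a countable vertex type (restriction coupling);
* `KozmaNitzan.Conj1.targetSet` — with a finite target SET `T` in place of the vertex `b` (wiring `wireW T`,
  `prodBernoulli_wireW_real_openConn`; KN p. 22 "we identified the set `T` to a point"), for `t ≥ 0`;
* `KozmaNitzan.Conj1.lattice_openConnIn` — for bond percolation `P_p` on `ℤ^d` inside a finite set `S`:
  `P_p(o ↔ A in S) · t ≤ P_p(o ↔ T in S)` whenever `0 ≤ t ≤ P_p(a ↔ T in S)` for all `a ∈ A`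
  (restricted weights `restrW S (lattW d p)`, `prodBernoulli_restrW_real_biUnion_openConn`).

## References

* G. Kozma, S. Nitzan, arXiv:2401.12397 (2024), Conjecture 1 (p. 3), §4 p. 22 (identifying a set to a point),
  p. 24 (the subgraph `A`).
* G. Grimmett, *Percolation*, 2nd ed. (1999), §1.3 (product measure), §1.6 (subgraphs).
-/

noncomputable section


namespace Literature.Probability.Percolation

open _root_.MeasureTheory LatticeModels

namespace KozmaNitzan.Conj1

/-- **Conjecture 1 over every finite vertex type** (from its `Fin n` typing): relabel along
`Fintype.equivFin`. [cite: KozmaNitzan2024, Conjecture 1 (p. 3)] -/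
theorem fintype
    (hC1 : ∀ (n : ℕ) (w : Sym2 (Fin n) → unitInterval) (A : Finset (Fin n)) (o b : Fin n) (t : ℝ),
      (∀ a ∈ A, t ≤ (prodBernoulli w).real (openConn a b)) →
      (prodBernoulli w).real (⋃ a ∈ A, openConn o a) * t ≤ (prodBernoulli w).real (openConn o b))
    (V : Type) [Fintype V] (w : Sym2 V → unitInterval) (A : Finset V) (o b : V) (t : ℝ)
    (hab : ∀ a ∈ A, t ≤ (prodBernoulli w).real (openConn a b)) :
    (prodBernoulli w).real (⋃ a ∈ A, openConn o a) * t ≤ (prodBernoulli w).real (openConn o b) := by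
  classical
  set e := Fintype.equivFin V with he
  have hf : Function.Injective (e.symm : Fin (Fintype.card V) → V) := e.symm.injective
  set w' : Sym2 (Fin (Fintype.card V)) → unitInterval := w ∘ Sym2.map e.symm with hw'
  have hmap := prodBernoulli_map_restrictConfig w hf
  -- transport of the probabilities
  have key : ∀ x y : V, (prodBernoulli w').real (openConn (e x) (e y)) =
      (prodBernoulli w).real (openConn x y) := by
    intro x y
    rw [hw', ← hmap, map_measureReal_apply (measurable_restrictConfig _) (measurableSet_openConn_holds _ _),
      restrictConfig_symm_preimage_openConn]
  have keyU : (prodBernoulli w').real (⋃ a ∈ A.map e.toEmbedding, openConn (e o) a) =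
      (prodBernoulli w).real (⋃ a ∈ A, openConn o a) := by
    rw [hw', ← hmap, map_measureReal_apply (measurable_restrictConfig _)
      (Finset.measurableSet_biUnion _ fun a _ => measurableSet_openConn_holds _ _)]
    congr 1
    exact restrictConfig_symm_preimage_biUnion_openConn e o A
  have h1 := hC1 (Fintype.card V) w' (A.map e.toEmbedding) (e o) (e b) t (by
    intro a ha
    rw [Finset.mem_map_equiv] at ha
    have := hab (e.symm a) ha
    rwa [← key, Equiv.apply_symm_apply] at this)
  rwa [key, keyU] at h1

/-- **Conjecture 1 for finitely supported weights on a countable vertex type**: if `w` vanishes on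
every pair not inside the finite set `S`, then Conjecture 1 holds for `prodBernoulli w` with `A ⊆ S`,
`o, b ∈ S` (restriction coupling to the finite graph on `S`, on which the configuration a.s. lives).
[cite: KozmaNitzan2024, Conjecture 1 (p. 3)] -/
theorem finSupp
    (hC1 : ∀ (n : ℕ) (w : Sym2 (Fin n) → unitInterval) (A : Finset (Fin n)) (o b : Fin n) (t : ℝ),
      (∀ a ∈ A, t ≤ (prodBernoulli w).real (openConn a b)) →
      (prodBernoulli w).real (⋃ a ∈ A, openConn o a) * t ≤ (prodBernoulli w).real (openConn o b))
    (V : Type) [Countable V] (w : Sym2 V → unitInterval) (S : Finset V)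
    (hw : ∀ e : Sym2 V, (∃ x ∈ e, x ∉ S) → w e = 0)
    (A : Finset V) (o b : V) (hAS : A ⊆ S) (ho : o ∈ S) (hb : b ∈ S) (t : ℝ)
    (hab : ∀ a ∈ A, t ≤ (prodBernoulli w).real (openConn a b)) :
    (prodBernoulli w).real (⋃ a ∈ A, openConn o a) * t ≤ (prodBernoulli w).real (openConn o b) := by
  classical
  set Sset : Set V := ↑S with hSset
  set f : Sset → V := Subtype.val with hf
  have hfi : Function.Injective f := Subtype.val_injective
  set w' : Sym2 Sset → unitInterval := w ∘ Sym2.map f with hw'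
  have hmap := prodBernoulli_map_restrictConfig w hfi
  -- a.s. every open pair lies inside `S`
  have hae : ∀ᵐ ω ∂prodBernoulli w, ∀ e ∈ ω, ∀ x ∈ e, x ∈ Sset := by
    have hZ : ({e : Sym2 V | ∃ x ∈ e, x ∉ S}).Countable := Set.to_countable _
    filter_upwards [prodBernoulli_ae_forall_notMem w hZ fun e he => hw e he] with ω hω e he x hx
    by_contra hxS
    exact hω e ⟨x, hx, hxS⟩ he
  -- transport of connection probabilities
  have key : ∀ (x y : V) (hx : x ∈ Sset) (hy : y ∈ Sset),
      (prodBernoulli w').real (openConn (⟨x, hx⟩ : Sset) ⟨y, hy⟩) = (prodBernoulli w).real (openConn x y) := by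
    intro x y hx hy
    rw [hw', ← hmap, map_measureReal_apply (measurable_restrictConfig _) (measurableSet_openConn_holds _ _)]
    refine measureReal_congr ?_
    filter_upwards [hae] with ω hω
    refine propext ⟨fun h' => ?_, fun h' => ?_⟩
    · exact reachable_map_of_restrictConfig hfi ω h'
    · exact reachable_restrictConfig_subtype_of_reachable hω hx hy h'
  set A' : Finset Sset := A.subtype (· ∈ Sset) with hA'
  have keyU : (prodBernoulli w').real (⋃ a ∈ A', openConn (⟨o, ho⟩ : Sset) a) =
      (prodBernoulli w).real (⋃ a ∈ A, openConn o a) := by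
    rw [hw', ← hmap, map_measureReal_apply (measurable_restrictConfig _)
      (Finset.measurableSet_biUnion _ fun a _ => measurableSet_openConn_holds _ _)]
    refine measureReal_congr ?_
    filter_upwards [hae] with ω hω
    change (ω ∈ restrictConfig f ⁻¹' (⋃ a ∈ A', openConn (⟨o, ho⟩ : Sset) a)) =
      (ω ∈ ⋃ a ∈ A, openConn o a)
    simp only [Set.mem_preimage, Set.mem_iUnion, exists_prop, hA', Finset.mem_subtype, eq_iff_iff]
    constructor
    · rintro ⟨a, ha, h'⟩
      exact ⟨a, ha, reachable_map_of_restrictConfig hfi ω h'⟩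
    · rintro ⟨a, ha, h'⟩
      exact ⟨⟨a, hAS ha⟩, ha, reachable_restrictConfig_subtype_of_reachable hω ho (hAS ha) h'⟩
  have h1 := fintype hC1 Sset w' A' ⟨o, ho⟩ ⟨b, hb⟩ t (by
    intro a ha
    rw [hA', Finset.mem_subtype] at ha
    have := hab a ha
    rwa [← key a b a.2 hb] at this)
  rwa [key, keyU] at h1

/-- **Conjecture 1 with a finite target SET** (the set `T` identified to a point, KN p. 22): for finitely
supported weights on a countable vertex type, `A, T ⊆ S`, `o ∈ S`, `T ≠ ∅`, and `0 ≤ t ≤ P_w(a ↔ T)` for all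
`a ∈ A`: `P_w(o ↔ A) · t ≤ P_w(o ↔ T)`. Proof: Conjecture 1 for the wired weights `wireW T w` and any
`t₀ ∈ T` (`prodBernoulli_wireW_real_openConn`), and monotonicity of `{o ↔ A}` under wiring.
[cite: KozmaNitzan2024, Conjecture 1 (p. 3) and §4 p. 22] -/
theorem targetSet
    (hC1 : ∀ (n : ℕ) (w : Sym2 (Fin n) → unitInterval) (A : Finset (Fin n)) (o b : Fin n) (t : ℝ),
      (∀ a ∈ A, t ≤ (prodBernoulli w).real (openConn a b)) →
      (prodBernoulli w).real (⋃ a ∈ A, openConn o a) * t ≤ (prodBernoulli w).real (openConn o b))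
    (V : Type) [Countable V] (w : Sym2 V → unitInterval) (S : Finset V)
    (hw : ∀ e : Sym2 V, (∃ x ∈ e, x ∉ S) → w e = 0)
    (A T : Finset V) (o : V) (hAS : A ⊆ S) (hTS : T ⊆ S) (ho : o ∈ S) (hT : T.Nonempty)
    (t : ℝ) (ht : 0 ≤ t)
    (haT : ∀ a ∈ A, t ≤ (prodBernoulli w).real (⋃ y ∈ T, openConn a y)) :
    (prodBernoulli w).real (⋃ a ∈ A, openConn o a) * t ≤ (prodBernoulli w).real (⋃ y ∈ T, openConn o y) := by
  obtain ⟨t₀, ht₀⟩ := hT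
  have hw' : ∀ e : Sym2 V, (∃ x ∈ e, x ∉ S) → wireW (↑T : Set V) w e = 0 := by
    intro e he
    rw [wireW_apply_of_not_mem w ?_, hw e he]
    obtain ⟨x, hx, hxS⟩ := he
    exact fun h' => hxS (hTS (h'.1 x hx))
  have h1 := finSupp hC1 V (wireW (↑T : Set V) w) S hw' A o t₀ hAS ho (hTS ht₀) t (by
    intro a ha
    rw [prodBernoulli_wireW_real_openConn w (↑T : Set V) (Finset.mem_coe.2 ht₀) a]
    exact haT a ha)
  rw [prodBernoulli_wireW_real_openConn w (↑T : Set V) (Finset.mem_coe.2 ht₀) o] at h1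
  have hmono : (prodBernoulli w).real (⋃ a ∈ A, openConn o a) ≤
      (prodBernoulli (wireW (↑T : Set V) w)).real (⋃ a ∈ A, openConn o a) :=
    prodBernoulli_real_biUnion_openConn_mono (le_wireW _ w) o _
  exact le_trans (mul_le_mul_of_nonneg_right hmono ht) h1

/-- **Conjecture 1 for bond percolation on `ℤ^d` inside a finite vertex set `S`**: for `A, T ⊆ S`,
`o ∈ S`, `T ≠ ∅` and `0 ≤ t ≤ P_p(a ↔ T in S)` for all `a ∈ A`:
`P_p(o ↔ A in S) · t ≤ P_p(o ↔ T in S)` (Conjecture 1 with a target set for the restricted weights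
`restrW S (lattW d p)`, whose connection events are the "in `S`" events of `P_p`,
`prodBernoulli_restrW_real_biUnion_openConn`). [cite: KozmaNitzan2024, Conjecture 1 (p. 3), §4 p. 24] -/
theorem lattice_openConnIn
    (hC1 : ∀ (n : ℕ) (w : Sym2 (Fin n) → unitInterval) (A : Finset (Fin n)) (o b : Fin n) (t : ℝ),
      (∀ a ∈ A, t ≤ (prodBernoulli w).real (openConn a b)) →
      (prodBernoulli w).real (⋃ a ∈ A, openConn o a) * t ≤ (prodBernoulli w).real (openConn o b))
    {d : ℕ} (p : unitInterval) (S A T : Finset (Site d)) (o : Site d)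
    (hAS : A ⊆ S) (hTS : T ⊆ S) (ho : o ∈ S) (hT : T.Nonempty) (t : ℝ) (ht : 0 ≤ t)
    (haT : ∀ a ∈ A, t ≤ (bondPercolation (zdGraph d) p).real (⋃ y ∈ T, openConnIn (↑S : Set (Site d)) a y)) :
    (bondPercolation (zdGraph d) p).real (⋃ a ∈ A, openConnIn (↑S : Set (Site d)) o a) * t ≤
      (bondPercolation (zdGraph d) p).real (⋃ y ∈ T, openConnIn (↑S : Set (Site d)) o y) := by
  set w : Sym2 (Site d) → unitInterval := restrW (↑S : Set (Site d)) (KozmaNitzan.lattW d p) with hw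
  have hfin : ∀ e : Sym2 (Site d), (∃ x ∈ e, x ∉ S) → w e = 0 :=
    (finSupp_restrW S (KozmaNitzan.lattW d p)).zero
  -- the three identifications `P_w(x ↔ U) = P_p(x ↔ U in S)` for `x ∈ S`
  have key : ∀ (x : Site d) (hx : x ∈ S) (U : Finset (Site d)),
      (prodBernoulli w).real (⋃ y ∈ U, openConn x y) =
        (bondPercolation (zdGraph d) p).real (⋃ y ∈ U, openConnIn (↑S : Set (Site d)) x y) := by
    intro x hx U
    have h := prodBernoulli_restrW_real_biUnion_openConn (KozmaNitzan.lattW d p) (↑S : Set (Site d))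
      (Finset.mem_coe.2 hx) (↑U : Set (Site d))
    rw [KozmaNitzan.prodBernoulli_lattW] at h
    simpa only [Finset.mem_coe] using h
  have h1 := targetSet hC1 (Site d) w S hfin A T o hAS hTS ho hT t ht (by
    intro a ha
    rw [key a (hAS ha) T]
    exact haT a ha)
  rwa [key o ho A, key o ho T] at h1

end KozmaNitzan.Conj1

end Literature.Probability.Percolation

end
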